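import Mathlib
import HarnessLib
import Summits.NavierStokesRegularity.FluidComputer.TriggeredTransferCascadePieces

/-!
# Gluing the physical pieces of a CASCADE: the summed force, the glued solution through level `n`
# on `[0, stop n)`, its energy and its values at the start times (door N1-FC, analysis half v2, file 4/5)

Cell `ns-blowup`, seat `ns-blowup-fc-prover-1` (g5; D-0074 GROUP C «bridge support», door N1-FC).
This is `TriggeredTransferGluing.lean` (this seat, g2) re-run over the ALPHABET-FREE type
`TriggerScheme.Cascade ν` (`TriggeredTransferCascade.lean`): the gluing recursion consumes only the
physical pieces, their windows and the junction `Cascade.vel_eq_vel_succ` (by `H¹`,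
`TriggeredTransferCascadePieces.lean`), so the g2 text carries over with `ρ : 𝒮.Cascade ν` (explicit
binder in every signature; theorems about a different type than `Run`'s). LABEL: E–C bookkeeping.
WHAT THIS IS NOT: not Navier–Stokes evidence and not a construction — statements about a `Cascade`, a
type inhabited in the tree only under OPEN door predicates; no instance is claimed.

* `force t x = Σ' n, frc n t x` — the summed zoomed triggers; on the window `start n ≤ t < stop n`
  only level `n` is active (`force_eq_frc`).
* `gvel n`, `gprs n` — the solution GLUED THROUGH LEVEL `n` (recursion: before `stop k` keep the glued
  field, after it switch to the piece of level `k+1`, pressures normalised at the origin — literally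
  `IsClassicalNSSolutionOn.glue`); `gvel_classical : IsClassicalNSSolutionOn (Ico 0 (stop n)) ν force
  (gvel n) (gprs n)` by induction along the junctions.
* stability `gvel_apply_of_lt_stop`, values `gvel_apply_start`, finite energy `gvel_energy`.

References: T. Tao, J. Amer. Math. Soc. 29 (2016) §1.3 [cite: Tao2016AveragedNS, §1.3]; J. T. Beale,
T. Kato, A. Majda, Comm. Math. Phys. 94 (1984) §1 (continuation by gluing) [cite: BealeKatoMajda1984, §1].
0 sorry; axioms ⊆ {propext, Classical.choice, Quot.sound}.
-/

noncomputable section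

namespace Summit.NavierStokesRegularity.FluidComputer.TriggeredTransfer.TriggerScheme.Cascade

open Set Filter Function MeasureTheory
open scoped Topology ENNReal ContDiff
open Literature.Analysis.FluidPDE
open Literature.Analysis.FluidPDE.FluidComputer (E3 Vel)

variable {𝒮 : TriggerScheme} {ν : ℝ}

/-! ## The summed force -/

/-- **The force of the cascade**: the sum of all zoomed triggers, `f(t, x) = Σ_n frc n t x` (at each
time at most one term is non-zero). [cite: Tao2016AveragedNS, §1.3] -/
def force (ρ : 𝒮.Cascade ν) : ℝ → Vel := fun t x => ∑' n, ρ.frc n t x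

/-- Off its own window a zoomed trigger contributes nothing: for `m ≠ n` and `start n ≤ t < stop n`,
`frc m t x = 0`. [folklore] -/
theorem frc_apply_eq_zero_of_ne (ρ : 𝒮.Cascade ν) {m n : ℕ} (hmn : m ≠ n) {t : ℝ} (h1 : ρ.start n ≤ t)
    (h2 : t < ρ.stop n) (x : E3) : ρ.frc m t x = 0 := by
  rcases lt_or_gt_of_ne hmn with hlt | hgt
  · -- earlier levels are switched off from `start (m+1) ≤ start n ≤ t` on
    have h : ρ.frc m t = 0 := ρ.frc_eq_zero_of_ge ((ρ.monotone_start (by omega)).trans h1)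
    rw [h]; rfl
  · -- later levels have not started their active phase: `t ≤ start m + margin m`
    have hle : t ≤ ρ.start m + ρ.margin m := by
      rcases (show m = n + 1 ∨ n + 2 ≤ m by omega) with rfl | hm
      · exact h2.le.trans (ρ.stop_le_start_succ_add_margin n)
      · have := ρ.stop_lt_start_add_two n
        have := ρ.monotone_start hm
        linarith [(ρ.margin_pos m).le]
    have h : ρ.frc m t = 0 := ρ.frc_eq_zero_of_le hle
    rw [h]; rfl

/-- **One active level at a time**: on the window `start n ≤ t < stop n` the summed force IS the
zoomed trigger of level `n`. [folklore] -/
theorem force_eq_frc (ρ : 𝒮.Cascade ν) {n : ℕ} {t : ℝ} (h1 : ρ.start n ≤ t) (h2 : t < ρ.stop n) :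
    ρ.force t = ρ.frc n t := by
  funext x
  exact tsum_eq_single n fun m hm => ρ.frc_apply_eq_zero_of_ne hm h1 h2 x

/-- The physical piece of level `n` solves the system with the SUMMED force on the open window
`(start n, stop n)` (there the summed force is its own trigger). [folklore] -/
theorem piece_classical_force (ρ : 𝒮.Cascade ν) (n : ℕ) :
    IsClassicalNSSolutionOn (Ioo (ρ.start n) (ρ.stop n)) ν ρ.force (ρ.vel n) (ρ.prs n) := by
  refine ((ρ.piece_classical n).mono (fun t ht => ⟨ht.1.le, ?_⟩) isOpen_Ioo.uniqueDiffOn).force_congr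
    fun t ht => (ρ.force_eq_frc ht.1.le ht.2).symm
  exact ht.2.le.trans (ρ.stop_le_life n)

/-! ## The glued fields -/

/-- **The velocity glued through level `n`**: the piece of level `0`; then, recursively, the glued
field before `stop k` and the piece of level `k+1` from `stop k` on. [folklore] -/
def gvel (ρ : 𝒮.Cascade ν) : ℕ → ℝ → Vel
  | 0 => ρ.vel 0
  | n + 1 => fun t => if t < ρ.stop n then gvel ρ n t else ρ.vel (n + 1) t

/-- **The pressure glued through level `n`**, normalised by its value at the origin at every stage
(the normalisation `IsClassicalNSSolutionOn.glue` performs). [folklore] -/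
def gprs (ρ : 𝒮.Cascade ν) : ℕ → ℝ → E3 → ℝ
  | 0 => fun t x => ρ.prs 0 t x - ρ.prs 0 t 0
  | n + 1 => fun t => if t < ρ.stop n then (fun x => gprs ρ n t x - gprs ρ n t 0)
      else fun x => ρ.prs (n + 1) t x - ρ.prs (n + 1) t 0

/-- `gvel 0 = vel 0`. [folklore] -/
@[simp] theorem gvel_zero (ρ : 𝒮.Cascade ν) : ρ.gvel 0 = ρ.vel 0 := rfl

/-- The recursion step of `gvel`. [folklore] -/
theorem gvel_succ (ρ : 𝒮.Cascade ν) (n : ℕ) :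
    ρ.gvel (n + 1) = fun t => if t < ρ.stop n then ρ.gvel n t else ρ.vel (n + 1) t := rfl

/-- `gprs 0` is the normalised pressure of the piece of level `0`. [folklore] -/
@[simp] theorem gprs_zero (ρ : 𝒮.Cascade ν) : ρ.gprs 0 = fun t x => ρ.prs 0 t x - ρ.prs 0 t 0 := rfl

/-- The recursion step of `gprs`. [folklore] -/
theorem gprs_succ (ρ : 𝒮.Cascade ν) (n : ℕ) :
    ρ.gprs (n + 1) = fun t => if t < ρ.stop n then (fun x => ρ.gprs n t x - ρ.gprs n t 0)
      else fun x => ρ.prs (n + 1) t x - ρ.prs (n + 1) t 0 := rfl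

/-- After `stop n` the field glued through level `n+1` is the piece of level `n+1`. [folklore] -/
theorem gvel_succ_apply_of_le (ρ : 𝒮.Cascade ν) {n : ℕ} {t : ℝ} (h : ρ.stop n ≤ t) :
    ρ.gvel (n + 1) t = ρ.vel (n + 1) t := by
  rw [gvel_succ]
  exact if_neg (not_lt.2 h)

/-- Before `stop n` the field glued through level `n+1` is the field glued through level `n`. [folklore] -/
theorem gvel_succ_apply_of_lt (ρ : 𝒮.Cascade ν) {n : ℕ} {t : ℝ} (h : t < ρ.stop n) : ρ.gvel (n + 1) t = ρ.gvel n t := by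
  rw [gvel_succ]
  exact if_pos h

/-- The glued pressures vanish at the origin. [folklore] -/
theorem gprs_apply_zero (ρ : 𝒮.Cascade ν) (n : ℕ) (t : ℝ) : ρ.gprs n t 0 = 0 := by
  cases n with
  | zero => exact sub_self _
  | succ n =>
    rw [gprs_succ]
    by_cases h : t < ρ.stop n
    · simp only [if_pos h, sub_self]
    · simp only [if_neg h, sub_self]

/-- Before `stop n` the pressure glued through level `n+1` is the pressure glued through level `n`
(the latter is already normalised). [folklore] -/
theorem gprs_succ_apply_of_lt (ρ : 𝒮.Cascade ν) {n : ℕ} {t : ℝ} (h : t < ρ.stop n) : ρ.gprs (n + 1) t = ρ.gprs n t := by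
  rw [gprs_succ]
  funext x
  simp only [if_pos h, ρ.gprs_apply_zero, sub_zero]

/-- After `stop n` the pressure glued through level `n+1` is the normalised pressure of level `n+1`. [folklore] -/
theorem gprs_succ_apply_of_le (ρ : 𝒮.Cascade ν) {n : ℕ} {t : ℝ} (h : ρ.stop n ≤ t) :
    ρ.gprs (n + 1) t = fun x => ρ.prs (n + 1) t x - ρ.prs (n + 1) t 0 := by
  rw [gprs_succ]
  exact if_neg (not_lt.2 h)

/-- **Stability**: later gluings do not change the velocity before `stop n`. [folklore] -/
theorem gvel_apply_of_lt_stop (ρ : 𝒮.Cascade ν) {n m : ℕ} (hnm : n ≤ m) {t : ℝ} (ht : t < ρ.stop n) :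
    ρ.gvel m t = ρ.gvel n t := by
  induction m, hnm using Nat.le_induction with
  | base => rfl
  | succ m hnm ih =>
    rw [ρ.gvel_succ_apply_of_lt (ht.trans_le (ρ.monotone_stop hnm)), ih]

/-- **Stability**: later gluings do not change the pressure before `stop n`. [folklore] -/
theorem gprs_apply_of_lt_stop (ρ : 𝒮.Cascade ν) {n m : ℕ} (hnm : n ≤ m) {t : ℝ} (ht : t < ρ.stop n) :
    ρ.gprs m t = ρ.gprs n t := by
  induction m, hnm using Nat.le_induction with
  | base => rfl
  | succ m hnm ih =>
    rw [ρ.gprs_succ_apply_of_lt (ht.trans_le (ρ.monotone_stop hnm)), ih]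

/-- From `start (n+1)` on (in particular on the overlap with level `n+1` and at the hand-over time)
the field glued through level `n` is the piece of level `n`. [folklore] -/
theorem gvel_apply_of_start_succ_le (ρ : 𝒮.Cascade ν) (n : ℕ) {t : ℝ} (ht : ρ.start (n + 1) ≤ t) :
    ρ.gvel n t = ρ.vel n t := by
  cases n with
  | zero => rfl
  | succ k => exact ρ.gvel_succ_apply_of_le ((ρ.stop_lt_start_add_two k).le.trans ht)

/-- **The glued field at the start times**: `gvel n (start n) = vel n (start n)` (the zoomed level
state), by the exact hand-over identity. [folklore] -/
theorem gvel_apply_start (ρ : 𝒮.Cascade ν) (n : ℕ) : ρ.gvel n (ρ.start n) = ρ.vel n (ρ.start n) := by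
  cases n with
  | zero => rfl
  | succ k =>
    rw [ρ.gvel_succ_apply_of_lt (ρ.start_succ_lt_stop k), ρ.gvel_apply_of_start_succ_le k le_rfl,
      ρ.vel_start_succ_eq]

/-! ## The glued fields are classical solutions on `[0, stop n)` -/

/-- **Gluing through level `n`** (`ν > 0`): `(gvel n, gprs n)` is an exact classical solution of
the system forced by the summed force on `[0, stop n)` — level `0` on `[0, stop 0)`, and at each
step `IsClassicalNSSolutionOn.glue` along the open overlap `(start (k+1), stop k)`, where the glued
field (= the piece of level `k`) and the piece of level `k+1` agree by the junction
`vel_eq_vel_succ`. [cite: BealeKatoMajda1984, §1] -/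
theorem gvel_classical (ρ : 𝒮.Cascade ν) (hν : 0 < ν) :
    ∀ n, IsClassicalNSSolutionOn (Ico 0 (ρ.stop n)) ν ρ.force (ρ.gvel n) (ρ.gprs n)
  | 0 => by
      have h : IsClassicalNSSolutionOn (Ico 0 (ρ.stop 0)) ν ρ.force (ρ.vel 0) (ρ.prs 0) := by
        refine ((ρ.piece_classical 0).mono (fun t ht => ⟨?_, ?_⟩)
          (uniqueDiffOn_Ico 0 (ρ.stop 0))).force_congr fun t ht => ?_
        · rw [ρ.start_zero]; exact ht.1
        · exact ht.2.le.trans (ρ.stop_le_life 0)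
        · exact (ρ.force_eq_frc (by rw [ρ.start_zero]; exact ht.1) ht.2).symm
      exact h.normalise_pressure
  | n + 1 => by
      have ih := gvel_classical ρ hν n
      have h₂ : IsClassicalNSSolutionOn (Ioo (ρ.start (n + 1)) (ρ.stop (n + 1))) ν ρ.force
          (ρ.vel (n + 1)) (ρ.prs (n + 1)) := ρ.piece_classical_force (n + 1)
      have heq : ∀ t ∈ Ioo (ρ.start (n + 1)) (ρ.stop n), ρ.gvel n t = ρ.vel (n + 1) t := by
        intro t ht
        rw [ρ.gvel_apply_of_start_succ_le n ht.1.le]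
        exact ρ.vel_eq_vel_succ_Ioo hν n ht
      rw [gvel_succ, gprs_succ]
      exact ih.glue h₂ (ρ.start_nonneg _) (ρ.start_succ_lt_stop n) (ρ.stop_lt_stop_succ n).le heq

/-! ## Energy of the glued fields -/

/-- **Finite energy of the glued field on `[0, stop n)`** (the maximum of finitely many piece bounds). [folklore] -/
theorem gvel_energy (ρ : 𝒮.Cascade ν) :
    ∀ n, ∃ C : ℝ≥0∞, C < ⊤ ∧ ∀ t ∈ Ico 0 (ρ.stop n), ∫⁻ x, ‖ρ.gvel n t x‖ₑ ^ 2 ≤ C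
  | 0 => by
      obtain ⟨C, hC, hb⟩ := ρ.piece_energy 0
      refine ⟨C, hC, fun t ht => hb t ⟨?_, ht.2.le.trans (ρ.stop_le_life 0)⟩⟩
      rw [ρ.start_zero]; exact ht.1
  | n + 1 => by
      obtain ⟨C₁, hC₁, hb₁⟩ := gvel_energy ρ n
      obtain ⟨C₂, hC₂, hb₂⟩ := ρ.piece_energy (n + 1)
      refine ⟨max C₁ C₂, max_lt hC₁ hC₂, fun t ht => ?_⟩
      by_cases h : t < ρ.stop n
      · rw [ρ.gvel_succ_apply_of_lt h]
        exact (hb₁ t ⟨ht.1, h⟩).trans (le_max_left _ _)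
      · rw [ρ.gvel_succ_apply_of_le (not_lt.1 h)]
        refine (hb₂ t ⟨?_, ht.2.le.trans (ρ.stop_le_life (n + 1))⟩).trans (le_max_right _ _)
        exact (ρ.start_succ_lt_stop n).le.trans (not_lt.1 h)

end Summit.NavierStokesRegularity.FluidComputer.TriggeredTransfer.TriggerScheme.Cascade

end
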